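import Literature.AnabelianGeometry.EtaleTheta.SettingModelPowHat
import Literature.AnabelianGeometry.EtaleTheta.SettingModelChiShearInner
import Literature.AnabelianGeometry.EtaleTheta.SettingModelCyclotomicCharacter
import HarnessLib

/-!
# A model of the [EtTh] §1 root, χ-twisted reshape: θ-EIGEN and T-EIGEN elements of `F̂₂` and the
# torus-rigidity TARGET TYPES (statement file (B★) of programme P-L2, rung (L2-T))

Mochizuki, *The étale theta function and its Frobenioid-theoretic manifestations*, Publ. RIMS **45** (2009)
[EtTh], §1, PRIMS PDF p. 12 («`Δ_X` … a profinite free group on 2 generators», «`(Ẑ(1) ≅) Δ_Θ`»: `G_K` acts on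
the cyclotomes through the cyclotomic character) [cite: MochizukiEtTh2009, §1 p.12]. Layer L6 of the abc-iut cell,
seat abc-iut-w5-d169 (gen 15), row PL2-LEAF-1 of abc-iut-L6-lead (§F v1.19ge (B)); typed from this seat's
farm-elaborated sizing scratch (gen 13, v3) over abc-iut-w5-d024's `powHat` (`SettingModelPowHat`), abc-iut-L2-t1 /
abc-iut-w5-d024's cyclotomic twist `twist` (`SettingModelChiTwist`), abc-iut-L2-t6's three-parameter affine action
`affTwist₃` (`SettingModelChiShearInner`) and abc-iut-w5-d091's cyclotomic character `chi p : G_{ℚ_p} →* Aut(Ẑ)`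
(`SettingModelCyclotomicCharacter`) — all consumed BY NAME; nothing of another seat is edited or restated.

CONTENTS — `Prop`-valued DEFINITIONS ONLY (target types; NOTHING is asserted about them here):
* `IsThetaEigen p w` — `w ∈ F̂₂` is a θ-EIGEN element for the cyclotomic twists: `θ_{χσ}(w) = w^{χσ(1)}` for every
  `σ ∈ G_{ℚ_p}` (the model `b = η x₁` is θ-eigen: `twist_bPow`);
* `ThetaFixedRigidity p` — the torus-FIXED form: an element fixed by every `θ_{χσ}` lies in `a^Ẑ`;
* `ThetaEigenRigidityConj p` — the CONJUGACY form of torus rigidity: if for every `σ` the twist `θ_{χσ}(w)` is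
  conjugate to `w^{χσ(1)}`, then `w` is conjugate to some `b^t` (`t ∈ Ẑ`);
* `IsTEigenConj p w` — `w` is T-EIGEN (conjugacy form): the torus law above AND the Kummer law «the generator
  `τ̂ = Inn(b) ∘ shear 2` of the stage-2 action (`affTwist₃ ⟨(ι 1, ι 2), 1⟩`) conjugates `w` to itself»;
* `TEigenRigidityConj p` — T-EIGEN RIGIDITY: a T-eigen element is conjugate to some `b^t`;
(The conjugacy torus form implies the T-eigen form by `fun h w hw => h w hw.1` — the Kummer conjunct is idle;
no theorem is stated here.)

HONEST FRAMING. Statements about OUR semi-synthetic model (`F₂hatT`, `twist`, `chi`, `powHat`, `affTwist₃`);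
`Prop` DEFINITIONS, nothing is asserted; their desk / kernel status is kept in the cell's plan/L6/DISCHARGE-L6.md,
not here. Deliberately NOT here: the on-the-nose form «θ-eigen ⇒ `w = a^s b^t a^{-s}`» (not needed by the ladder),
any binder of the cells hextΔ / hΘ, any import of the `SettingModelTate*` / `ThetaSettingHext*` files. Nothing of
[EtTh] / [IUTchII] / [IUTchIII] in print is asserted; no side is taken on [IUTchIII] Cor. 3.12; typed ≠ proved.
-/

namespace Literature.AnabelianGeometry.EtaleTheta.SettingModel

open Literature.AnabelianGeometry.SemiGraphs

/-- `w ∈ F̂₂` is a **θ-EIGEN element** for the cyclotomic image `χ(G_{ℚ_p}) ⊆ Ẑ^× = Aut(Ẑ)`: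
`θ_{χ(σ)}(w) = w^{χ(σ)(1)}` for every `σ ∈ G_{ℚ_p}`, where `θ_φ = twist φ : a ↦ a, b ↦ b^{φ 1}` is the cyclotomic
twist of the model and `powHat w : Ẑ → F̂₂` the one-parameter group through `w` (so `w^{u} := powHat w (u·1)`).
A `Prop` definition about OUR model; nothing is asserted. [cite: MochizukiEtTh2009, §1 p.12] -/
def IsThetaEigen (p : ℕ) [Fact p.Prime] (w : F₂hatT) : Prop :=
  ∀ σ : GQp p, twist (chi p σ) w = powHat w (chi p σ (iotaZ (Multiplicative.ofAdd 1)))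

/-- **Torus-FIXED rigidity** (target type, torus-only form): every element of `F̂₂` fixed by all the cyclotomic
twists `θ_{χ(σ)}`, `σ ∈ G_{ℚ_p}`, is a `Ẑ`-power of `a = η x₀`. A `Prop` definition about OUR model; nothing is
asserted. [cite: MochizukiEtTh2009, §1 p.12] -/
def ThetaFixedRigidity (p : ℕ) [Fact p.Prime] : Prop :=
  ∀ w : F₂hatT, (∀ σ : GQp p, twist (chi p σ) w = w) → ∃ s : ZH, w = powHat (eta (FreeGroup.of 0)) s

/-- **Torus rigidity, CONJUGACY form** (target type): if for every `σ ∈ G_{ℚ_p}` the twist `θ_{χ(σ)}(w)` is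
CONJUGATE in `F̂₂` to `w^{χ(σ)(1)}`, then `w` is conjugate to `b^t` for some `t ∈ Ẑ` (`b = η x₁`,
`b^t = powHat (η x₁) t`). A `Prop` definition about OUR model; nothing is asserted. [cite: MochizukiEtTh2009, §1 p.12] -/
def ThetaEigenRigidityConj (p : ℕ) [Fact p.Prime] : Prop :=
  ∀ w : F₂hatT, (∀ σ : GQp p, ∃ g : F₂hatT,
      twist (chi p σ) w = g * powHat w (chi p σ (iotaZ (Multiplicative.ofAdd 1))) * g⁻¹) →
    ∃ (g : F₂hatT) (t : ZH), w = g * powHat (eta (FreeGroup.of 1)) t * g⁻¹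

/-- `w ∈ F̂₂` is **T-EIGEN, conjugacy form**: BOTH the torus law (`θ_{χ(σ)}(w)` is conjugate to `w^{χ(σ)(1)}` for
every `σ ∈ G_{ℚ_p}`) AND the Kummer law (the generator `τ̂ = Inn(b) ∘ shear 2 = affTwist₃ ⟨(ι 1, ι 2), 1⟩` of the
stage-2 three-parameter action — inner part `ι 1`, shear part `ι 2`, trivial cyclotomic part — conjugates `w` to
itself). A `Prop` definition about OUR model; nothing is asserted. [cite: MochizukiEtTh2009, §1 p.12] -/
def IsTEigenConj (p : ℕ) [Fact p.Prime] (w : F₂hatT) : Prop :=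
  (∀ σ : GQp p, ∃ g : F₂hatT,
      twist (chi p σ) w = g * powHat w (chi p σ (iotaZ (Multiplicative.ofAdd 1))) * g⁻¹) ∧
  (∃ g : F₂hatT,
      affTwist₃ (⟨(iotaZ (Multiplicative.ofAdd 1), iotaZ (Multiplicative.ofAdd 2)), 1⟩ :
        (ZH × ZH) ⋊[diagAut] MulAut ZH) w = g * w * g⁻¹)

/-- **T-EIGEN RIGIDITY, conjugacy form** (the target type of record of rung (L2-T)): every T-eigen element of
`F̂₂` is conjugate to `b^t` for some `t ∈ Ẑ`. A `Prop` definition about OUR model; nothing is asserted.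
[cite: MochizukiEtTh2009, §1 p.12] -/
def TEigenRigidityConj (p : ℕ) [Fact p.Prime] : Prop :=
  ∀ w : F₂hatT, IsTEigenConj p w → ∃ (g : F₂hatT) (t : ZH), w = g * powHat (eta (FreeGroup.of 1)) t * g⁻¹

end Literature.AnabelianGeometry.EtaleTheta.SettingModel
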